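import Literature.MathematicalPhysics.QuantumFieldTheory.Balaban1983to89.B3Op116MajorantStep
import Literature.MathematicalPhysics.QuantumFieldTheory.Balaban1983to89.B3Op116FaceSums

/-!
# `Balaban1983to89.B3Op116MajorantStepBox` — T. Bałaban, *(Higgs)₂,₃ quantum fields in a finite volume. III. Renormalization*,
# Commun. Math. Phys. **88** (1983) 411–445 [Balaban1983Higgs3], (1.16) p. 414 / (2.6), (2.10) pp. 424–426 / p. 433:
# **ONE STEP `w ↦ G_k(□,X)V_k(A,B)w` ON A CELL-PRODUCT BOX IN THE (2.6)/(2.10) MAJORANT CURRENCY WITH A THREE-COMPONENT STATE**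
# (values · regular derivatives · PENDING FACE SHEETS): the torus step `B3Op116MajorantStep.row_step_le` survives the single layers that the
# Leibniz form of `V_k` leaves on `∂□` — the sheet read through a differentiated column is carried one step and composed with the next kernel
# (`B3Op116FaceSums.sum_majorant_face_pending_le`), the sheet read through a value column is resolved at once (`face_sum_kernel_mul_le`);
# exponent `a_K + a_v − 1` and rate `δ/(4L)` EXACTLY AS ON THE TORUS

statement-level skeleton of published theorems with citation tags; proofs where landed; nothing here is a claim about the Yang–Mills mass gap

PDF held: `paper:balaban1983-higgs-2-3-quantum-fields-finite-volume` p. 414 [PDF 4], p. 424 [14], p. 426 [16], pp. 432–433 [22–23].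

CITATION HEADER (lean-in-tree rule).  T. Bałaban, CMP **88** (1983) 411–445 [Balaban1983Higgs3]: (1.16) p. 414, (2.5)/(2.6) p. 424, (2.10) p. 426,
p. 433; T. Bałaban, CMP **85** (1982) 603–626 [Balaban1982Higgs1], (3.16) p. 615 (the averaging operators), (1.4) p. 604 (bonds).  Cell `lit-balaban`
(HOME `run/shared/lean/pub/lit-balaban/`), Phase-2 proof seat **p35** gen 26 (literature-prover-lit-balaban-p35-g26-0; free-target protocol G.5-34(d),
TAKING HOME/STATUS.md 2026-08-23T12:38:30Z + addendum, cc p40 / p33 / r14 / r15).  SKELETON rows **B3.Eq1.16** / **B3.Eq2.5** / **B3.Txt@433** /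
**B3.Prop1** (owner r15) — LOCATED ENGINE FILE, no head claim: F3 of the «(2.5) for (1.16) on a cell-product box `□` without the support clause» programme
(GAPS.md G-B3-16.A1, owner countersign 2026-08-23T12:25:18Z; p35 `DESIGN-FILE4.md` §14 (d)–(e); p40 `DESIGN-B3-116-box.md` §1c/§2).  Imports p35's
FILE 4β₁ `B3Op116MajorantStep` (`maj`, `convK`, `stepC`, `row_step_le` — the torus step, used VERBATIM for the regular part) and `B3Op116FaceSums`
(files 1–2 of the face engine: `face_sum_kernel_mul_le`, `sum_majorant_face_pending_le`); nothing restated.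

WHAT IS PRINTED (verbatim).  p. 414 [PDF 4]: *"for n, n′ sufficiently large, a kernel of the operator (1.16) is a sufficiently regular function of
both variables … uniformly bounded by O(1)(e(L^kε)^{1−α})^{n+n′}"*; p. 433 [PDF 23]: *"we take a cube □ of size 3r(L^kε) … We have B̃ = B̃₀ + B̃′, and we
expand in B̃′ … we include the operators (1.16) … into the external fields"* — the use of (2.5) for (1.16) on a cube with the perturbation field
supported up to `∂□` (G-B3-16.A1), where the Leibniz rows of FILE 4α (`B3Op116LeibnizRows`) restricted to the bonds of `□` leave face charges
`ε⁻¹·e·Ã_normal·w` (p40 `DESIGN-B3-116-box.md` §1c).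

THE STATE (DESIGN-FILE4 §14 (d)).  For a field `w` of the chain, anchored at the source `x′`: values `‖w(y)‖ ≤ V(y) ≤ 𝔪(c_v, a_v)(y,x′)`;
derivatives `‖D_Bw(b)‖ ≤ D(b) ≤ 𝔪(c_d, a_v − 1)(b₋,x′) + Σ_iΣ_{u∈F_i} 𝔪(c₁, 1)(b₋,u)·S_i(u)` — a REGULAR majorant plus the PENDING SHEETS `0 ≤ S_i ≤
𝔪(c_S, a_v − 1)(·,x′)` on the faces `F_i ⊆ {u : u_{ν_i} = c_i}` of `□` (finitely many hyperplane pieces), read through the differentiated column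
`𝔪(c₁,1)` of the CURRENT propagator ((2.10) on boxes at every bond, [B1] p. 611 / [B4] p. 573: p35 g21 `B3Ineq210RegularBox`).

WHAT THIS FILE PROVES (pure bookkeeping on `T_ε`; sums over all bonds/sites — on a box the charges vanish off `□`, an upper bound).
* §1 `faceK` / `pendK` (the constants of the two face lemmas in the `maj`/`convK` vocabulary) and their nonnegativity.
* §2 `pair_pend_site_le` / `pair_pend_src_le` / `pair_pend_tgt_le`: the PENDING part of the derivative state against the row's kernel `K ≤ 𝔪(c_K,a_K)(p,·)`
  (`a_K > 0`, `a_v > 2`): `≤ d·n_F·𝔪(c_Kc₁c_S·K_P, a_K + (a_v−1); δ/4)(p,x′)` — composed, face by face; `pair_face_le`: the face charges `Σ_iΣ_{y∈F_i}V(y)K(y)`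
  against a column of exponent `a_K > 1`: `≤ n_F·𝔪(c_Kc_v·K_F, a_K + a_v − 1; δ/2)(p,x′)`.
* §3 **`row_step_box_deriv_le`** (`a_K > 0`, any column): FILE 4α's bulk row `Σ_b[κ₁D(b)K(b₊) + (κ₂V(b₋)+κ₁D(b))K(b₋) + κ₃V(b₊)K(b₊)] + κ₄·(block
  averages)` against the three-component state `≤ 𝔪_k(stepBoxC, a_K + a_v − 1; δ/(4L))(p,x′)` — `row_step_le` for the regular part, §2 for the pending
  part; **`row_step_box_le`** (`a_K > 1`, a value column): the same PLUS this step's face charges `κ_F·Σ_iΣ_{y∈F_i}V(y)K(y)`, `≤ 𝔪_k(stepBoxVC, …)` —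
  THE VALUE RECURSION CLOSES ON A BOX; for a derivative column the face charges are the next pending sheet (left to the caller; at the last
  differentiated end they are `B3Op116FaceSumsBorderline`'s height sum — the end-point margin).  Constants `stepBoxC`/`stepBoxVC` explicit (defs).
HONEST SCOPE.  Abstract `K`, `V`, `D`, `S`: which kernels and charges occur (the box Leibniz rows with entering/exiting legs — p40 g77's
`B3Op116CollarSources` / a sequel), the induction over the `V_k`-insertions (F4 of `DESIGN-FILE4.md` §14 (e), twin of `B3Op116DKernelRegularTorus`'s
`state_op116`) and the mixed / Hölder ends (F5) are NOT here.  No `def … : Prop`, no `sorry`; axioms standard.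
-/

noncomputable section

open scoped BigOperators

namespace Literature.MathematicalPhysics.QuantumFieldTheory.Balaban1983to89.B3Op116MajorantStepBox

open B1Eq230FluctCov (Ix)
open B1Ineq234Concrete (nCol)
open HiggsAveraging (blockK blockIter)
open HiggsCovariancePos (sum_site_dir)
open B3Op116MajorantStep (maj maj_nonneg maj_rate_mono maj_const_mono maj_add mul_maj maj_shift_right convK convK_nonneg
  stepC stepC_nonneg row_step_le)
open B3Op116FaceSums (face_sum_kernel_mul_le sum_majorant_face_pending_le)

variable {P : HiggsLattice.Params} {N : ℕ}

/-! ## §1 The constants of the face lemmas in the `maj` vocabulary -/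

section Constants

/-- The constant of `B3Op116FaceSums.face_conv_majorant_le`: `K_F(a₁,a₂;δ) = (8d/δ)^{d−1}(ε^{d−1})^{−1}(L^{a₁−1}/(L^{a₁−1}−1) + L^{a₂−1}/(L^{a₂−1}−1))`.
[cite: Balaban1983Higgs3, (2.6) p.424, (2.10) p.426] -/
def faceK (P : HiggsLattice.Params) (δ a₁ a₂ : ℝ) : ℝ :=
  (8 * P.d / δ) ^ (P.d - 1) * (P.mesh 0 ^ (P.d - 1))⁻¹ *
    ((P.L : ℝ) ^ (a₁ - 1) / ((P.L : ℝ) ^ (a₁ - 1) - 1) + (P.L : ℝ) ^ (a₂ - 1) / ((P.L : ℝ) ^ (a₂ - 1) - 1))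

/-- `K_F ≥ 0` for `a₁, a₂ > 1`, `δ > 0`, `L > 1`. [cite: Balaban1983Higgs3, (2.10) p.426] -/
theorem faceK_nonneg (hL : 1 < P.L) {δ a₁ a₂ : ℝ} (hδ : 0 < δ) (ha₁ : 1 < a₁) (ha₂ : 1 < a₂) : 0 ≤ faceK P δ a₁ a₂ := by
  have hL1 : (1 : ℝ) < (P.L : ℝ) := by exact_mod_cast hL
  have h1 : 0 < (P.L : ℝ) ^ (a₁ - 1) - 1 := by have := Real.one_lt_rpow hL1 (by linarith : 0 < a₁ - 1); linarith
  have h2 : 0 < (P.L : ℝ) ^ (a₂ - 1) - 1 := by have := Real.one_lt_rpow hL1 (by linarith : 0 < a₂ - 1); linarith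
  have h3 : 0 ≤ (P.L : ℝ) ^ (a₁ - 1) := Real.rpow_nonneg (by positivity) _
  have h4 : 0 ≤ (P.L : ℝ) ^ (a₂ - 1) := Real.rpow_nonneg (by positivity) _
  have := P.mesh_pos 0
  unfold faceK
  positivity

/-- The constant of the composed («pending-sheet») step `B3Op116FaceSums.sum_majorant_face_pending_le` for unit input constants:
`K_P(p,s;δ) = K_conv(p,1;δ)·K_F(p+1,s;δ/2)`. [cite: Balaban1983Higgs3, (2.6) p.424, (2.10) p.426] -/
def pendK (P : HiggsLattice.Params) (N : ℕ) (δ p s : ℝ) : ℝ :=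
  convK P N δ p 1 * faceK P (δ / 2) (p + 1) s

/-- `K_P ≥ 0` for `p > 0`, `s > 1`. [cite: Balaban1983Higgs3, (2.10) p.426] -/
theorem pendK_nonneg (hL : 1 < P.L) {δ p s : ℝ} (hδ : 0 < δ) (hp : 0 < p) (hs : 1 < s) : 0 ≤ pendK P N δ p s :=
  mul_nonneg (convK_nonneg hL hδ hp one_pos) (faceK_nonneg hL (by linarith) (by linarith) hs)

end Constants

/-! ## §2 The two new pairings of a row on a box: the pending part of the derivative state, and the face charges -/

section Pairings

variable (hL : 1 < P.L) {k : ℕ} {δ : ℝ} (hδ : 0 < δ) (hδ1 : δ ≤ 1)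
  {aK av cK cv cS c₁ : ℝ} (hcK : 0 ≤ cK) (hcv : 0 ≤ cv) (hcS : 0 ≤ cS) (hc₁ : 0 ≤ c₁)
  (i₀ : Ix N) (p x' : HiggsLattice.Site P 0)
  {nF : ℕ} (F : Fin nF → Finset (HiggsLattice.Site P 0)) (ν : Fin nF → Fin P.d)
  (c : (i : Fin nF) → ZMod (P.sitesPerDir 0 (ν i))) (hF : ∀ i, ∀ u ∈ F i, u (ν i) = c i)
  (K : HiggsLattice.Site P 0 → ℝ) (hK0 : ∀ y, 0 ≤ K y) (hK : ∀ y, K y ≤ maj P k cK aK δ p y)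
  (Vf : HiggsLattice.Site P 0 → ℝ) (hV0 : ∀ y, 0 ≤ Vf y) (hV : ∀ y, Vf y ≤ maj P k cv av δ y x')
  (S : Fin nF → HiggsLattice.Site P 0 → ℝ) (hS0 : ∀ i, ∀ u ∈ F i, 0 ≤ S i u)
  (hS : ∀ i, ∀ u ∈ F i, S i u ≤ maj P k cS (av - 1) δ u x')
include hL hδ hδ1 i₀ hF

section Pend
include hcK hcS hc₁ hK hS0 hS

/-- **The pending part of the derivative state against a kernel read at the sites** (`a_K > 0`, `a_v > 2`): with the pending density
`S_i ≤ 𝔪(c_S, a_v − 1)(·,x′)` on the faces `F_i ⊆ {u_{ν_i} = c_i}` read through the current differentiated column `𝔪(c₁, 1)(z,·)`,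
`Σ_z K(z)·[Σ_i Σ_{u∈F_i} 𝔪(c₁,1;δ)(z,u)S_i(u)] ≤ n_F·𝔪(c_K c₁ c_S K_P(a_K, a_v−1), a_K + (a_v − 1); δ/4)(p,x′)` — `B3Op116FaceSums.sum_majorant_face_pending_le`
face by face. [cite: Balaban1983Higgs3, (1.16) p.414, (2.6) p.424, (2.10) p.426] -/
theorem pair_pend_site_le (haK : 0 < aK) (hav : 2 < av) :
    ∑ z : HiggsLattice.Site P 0, K z * ∑ i : Fin nF, ∑ u ∈ F i, maj P k c₁ 1 δ z u * S i u
      ≤ (nF : ℝ) * maj P k (cK * c₁ * cS * pendK P N δ aK (av - 1)) (aK + (av - 1)) (δ / 2 / 2) p x' := by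
  have hs : 1 < av - 1 := by linarith
  -- one face
  have hface : ∀ i : Fin nF, ∑ z : HiggsLattice.Site P 0, K z * ∑ u ∈ F i, maj P k c₁ 1 δ z u * S i u
      ≤ maj P k (cK * c₁ * cS * pendK P N δ aK (av - 1)) (aK + (av - 1)) (δ / 2 / 2) p x' := by
    intro i
    have hin0 : ∀ z, 0 ≤ ∑ u ∈ F i, maj P k c₁ 1 δ z u * S i u :=
      fun z => Finset.sum_nonneg fun u hu => mul_nonneg (maj_nonneg hc₁ z u) (hS0 i u hu)
    calc ∑ z : HiggsLattice.Site P 0, K z * ∑ u ∈ F i, maj P k c₁ 1 δ z u * S i u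
        ≤ ∑ z : HiggsLattice.Site P 0, maj P k cK aK δ p z * ∑ u ∈ F i, maj P k c₁ 1 δ z u * S i u :=
          Finset.sum_le_sum fun z _ => mul_le_mul_of_nonneg_right (hK z) (hin0 z)
      _ ≤ _ := by
          have h := sum_majorant_face_pending_le (P := P) (N := N) hL hδ hδ1 haK hs hcK hc₁ hcS i₀ (hF i) p x' (S i)
            (hS0 i) (fun u hu => hS i u hu)
          refine h.trans (le_of_eq ?_)
          unfold maj pendK convK faceK
          refine Finset.sum_congr rfl fun j _ => ?_
          ring_nf
  calc ∑ z : HiggsLattice.Site P 0, K z * ∑ i : Fin nF, ∑ u ∈ F i, maj P k c₁ 1 δ z u * S i u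
      = ∑ i : Fin nF, ∑ z : HiggsLattice.Site P 0, K z * ∑ u ∈ F i, maj P k c₁ 1 δ z u * S i u := by
        rw [Finset.sum_comm]; exact Finset.sum_congr rfl fun z _ => Finset.mul_sum _ _ _
    _ ≤ ∑ _i : Fin nF, maj P k (cK * c₁ * cS * pendK P N δ aK (av - 1)) (aK + (av - 1)) (δ / 2 / 2) p x' :=
        Finset.sum_le_sum fun i _ => hface i
    _ = _ := by rw [Finset.sum_const, Finset.card_univ, Fintype.card_fin, nsmul_eq_mul]

/-- **The pending part of the derivative state against the kernel read at the bond BASE**: `Σ_b [Σ_iΣ_{u∈F_i}𝔪(c₁,1)(b₋,u)S_i(u)]·K(b₋)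
≤ d·n_F·𝔪(c_Kc₁c_SK_P, a_K + (a_v−1); δ/4)(p,x′)` (bonds = sites × directions). [cite: Balaban1983Higgs3, (1.16) p.414, (2.10) p.426] [cite: Balaban1982Higgs1, (1.4) p.604] -/
theorem pair_pend_src_le (haK : 0 < aK) (hav : 2 < av) :
    ∑ b : HiggsLattice.PBond P 0, (∑ i : Fin nF, ∑ u ∈ F i, maj P k c₁ 1 δ b.src u * S i u) * K b.src
      ≤ (P.d : ℝ) * ((nF : ℝ) * maj P k (cK * c₁ * cS * pendK P N δ aK (av - 1)) (aK + (av - 1)) (δ / 2 / 2) p x') := by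
  have h := pair_pend_site_le hL hδ hδ1 hcK hcS hc₁ i₀ p x' F ν c hF K hK S hS0 hS haK hav
  have hsd := sum_site_dir (P := P) (k := 0)
    (fun z (_μ : Fin P.d) => (∑ i : Fin nF, ∑ u ∈ F i, maj P k c₁ 1 δ z u * S i u) * K z)
  rw [← hsd]
  simp only [Finset.sum_const, Finset.card_univ, Fintype.card_fin, nsmul_eq_mul]
  rw [← Finset.mul_sum]
  refine mul_le_mul_of_nonneg_left ?_ (Nat.cast_nonneg _)
  simpa only [mul_comm] using h

/-- **The pending part against the kernel read at the bond HEAD** (one lattice step: a factor `e` on `c_K`). [cite: Balaban1983Higgs3, (1.16) p.414, (2.10) p.426] -/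
theorem pair_pend_tgt_le (haK : 0 < aK) (hav : 2 < av) :
    ∑ b : HiggsLattice.PBond P 0, (∑ i : Fin nF, ∑ u ∈ F i, maj P k c₁ 1 δ b.src u * S i u) * K b.tgt
      ≤ (P.d : ℝ) * ((nF : ℝ) * maj P k (Real.exp 1 * cK * c₁ * cS * pendK P N δ aK (av - 1)) (aK + (av - 1)) (δ / 2 / 2) p x') := by
  -- the shifted kernel `z ↦ K(z + e_μ)` is majorised with the constant `e·c_K`, direction by direction
  have hsd := sum_site_dir (P := P) (k := 0)
    (fun z (μ : Fin P.d) => (∑ i : Fin nF, ∑ u ∈ F i, maj P k c₁ 1 δ z u * S i u) * K (z.shift μ))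
  have hb : ∑ b : HiggsLattice.PBond P 0, (∑ i : Fin nF, ∑ u ∈ F i, maj P k c₁ 1 δ b.src u * S i u) * K b.tgt
      = ∑ z : HiggsLattice.Site P 0, ∑ μ : Fin P.d, (∑ i : Fin nF, ∑ u ∈ F i, maj P k c₁ 1 δ z u * S i u) * K (z.shift μ) := by
    rw [hsd]; rfl
  rw [hb, Finset.sum_comm]
  have hμ : ∀ μ : Fin P.d, ∑ z : HiggsLattice.Site P 0, (∑ i : Fin nF, ∑ u ∈ F i, maj P k c₁ 1 δ z u * S i u) * K (z.shift μ)
      ≤ (nF : ℝ) * maj P k (Real.exp 1 * cK * c₁ * cS * pendK P N δ aK (av - 1)) (aK + (av - 1)) (δ / 2 / 2) p x' := by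
    intro μ
    have h := pair_pend_site_le hL hδ hδ1 (mul_nonneg (Real.exp_nonneg _) hcK) hcS hc₁ i₀ p x' F ν c hF
      (fun z => K (z.shift μ)) (fun z => (hK (z.shift μ)).trans (maj_shift_right hδ hδ1 hcK p z μ)) S hS0 hS haK hav
    simpa only [mul_comm] using h
  calc ∑ μ : Fin P.d, ∑ z : HiggsLattice.Site P 0, (∑ i : Fin nF, ∑ u ∈ F i, maj P k c₁ 1 δ z u * S i u) * K (z.shift μ)
      ≤ ∑ _μ : Fin P.d, (nF : ℝ) * maj P k (Real.exp 1 * cK * c₁ * cS * pendK P N δ aK (av - 1)) (aK + (av - 1)) (δ / 2 / 2) p x' :=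
        Finset.sum_le_sum fun μ _ => hμ μ
    _ = _ := by rw [Finset.sum_const, Finset.card_univ, Fintype.card_fin, nsmul_eq_mul]

end Pend

section Face
include hcK hcv hK0 hK hV0 hV

omit i₀ in
/-- **The face charges against a kernel of exponent `a_K > 1`** (a VALUE column; `a_v > 1`): `Σ_iΣ_{y∈F_i} V(y)K(y) ≤
n_F·𝔪(c_Kc_vK_F(a_K,a_v;δ), a_K + a_v − 1; δ/2)(p,x′)` — `B3Op116FaceSums.face_sum_kernel_mul_le` face by face; for a DIFFERENTIATED column
(`a_K = 1`) this pairing is NOT resolved here (it is the new pending sheet of the next step, `B3Op116FaceSumsBorderline` at the end-point).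
[cite: Balaban1983Higgs3, (1.16) p.414, (2.6) p.424, (2.10) p.426] -/
theorem pair_face_le (haK : 1 < aK) (hav : 1 < av) :
    ∑ i : Fin nF, ∑ y ∈ F i, Vf y * K y
      ≤ (nF : ℝ) * maj P k (cK * cv * faceK P δ aK av) (aK + av - 1) (δ / 2) p x' := by
  have hface : ∀ i : Fin nF, ∑ y ∈ F i, Vf y * K y ≤ maj P k (cK * cv * faceK P δ aK av) (aK + av - 1) (δ / 2) p x' := by
    intro i
    have h := face_sum_kernel_mul_le (P := P) hL hδ hδ1 haK hav hcK hcv (hF i) p x' K Vf (fun u _ => hK0 u) (fun u _ => hV0 u)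
      (fun u _ => hK u) (fun u _ => hV u)
    simp only [mul_comm (Vf _) (K _)]
    refine h.trans (le_of_eq ?_)
    unfold maj faceK
    rfl
  calc ∑ i : Fin nF, ∑ y ∈ F i, Vf y * K y
      ≤ ∑ _i : Fin nF, maj P k (cK * cv * faceK P δ aK av) (aK + av - 1) (δ / 2) p x' := Finset.sum_le_sum fun i _ => hface i
    _ = _ := by rw [Finset.sum_const, Finset.card_univ, Fintype.card_fin, nsmul_eq_mul]

end Face

end Pairings

/-! ## §3 THE STEP ON A BOX: the row of `G_k(□,X)V_k(A,B)w` with a three-component state (values, regular derivatives, pending sheet) -/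

section StepBox

/-- the constant of the derivative-column step on a box: the torus constant `stepC` plus the two pending pairings.
[cite: Balaban1983Higgs3, (1.16) p.414, (2.10) p.426] -/
def stepBoxC (P : HiggsLattice.Params) (N : ℕ) (k nF : ℕ) (δ aK av cK cv cd cS c₁ κ₁ κ₂ κ₃ κ₄ : ℝ) : ℝ :=
  stepC P N k δ aK av cK cv cd κ₁ κ₂ κ₃ κ₄
    + (P.d : ℝ) * ((nF : ℝ) * (κ₁ * ((Real.exp 1 * cK * c₁ * cS + cK * c₁ * cS) * pendK P N δ aK (av - 1))))

/-- `stepBoxC ≥ 0`. [cite: Balaban1983Higgs3, (2.10) p.426] -/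
theorem stepBoxC_nonneg (hL : 1 < P.L) (k nF : ℕ) {δ aK av cK cv cd cS c₁ κ₁ κ₂ κ₃ κ₄ : ℝ} (hδ : 0 < δ) (haK : 0 < aK)
    (hav : 2 < av) (hcK : 0 ≤ cK) (hcv : 0 ≤ cv) (hcd : 0 ≤ cd) (hcS : 0 ≤ cS) (hc₁ : 0 ≤ c₁) (hκ₁ : 0 ≤ κ₁) (hκ₂ : 0 ≤ κ₂)
    (hκ₃ : 0 ≤ κ₃) (hκ₄ : 0 ≤ κ₄) : 0 ≤ stepBoxC P N k nF δ aK av cK cv cd cS c₁ κ₁ κ₂ κ₃ κ₄ := by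
  have h1 := stepC_nonneg hL k (N := N) (κ₁ := κ₁) (κ₂ := κ₂) (κ₃ := κ₃) (κ₄ := κ₄) hδ haK (show 1 < av by linarith)
    hcK hcv hcd hκ₁ hκ₂ hκ₃ hκ₄
  have h2 := pendK_nonneg hL (N := N) hδ haK (by linarith : 1 < av - 1)
  have he := Real.exp_nonneg (1 : ℝ)
  unfold stepBoxC
  positivity

/-- **ONE STEP ON A BOX, ANY COLUMN** (`a_K > 0`: value OR derivative column).  Hypotheses: the kernel `K ≥ 0` of the row majorised with exponent
`a_K` from the evaluation point `p`; the THREE-COMPONENT STATE of `w` anchored at the source `x′` — values `V ≤ 𝔪(c_v, a_v)` (`a_v > 2`), derivatives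
`D(b) ≤ 𝔪(c_d, a_v − 1)(b₋,x′) + Σ_iΣ_{u∈F_i} 𝔪(c₁, 1)(b₋,u)·S_i(u)` (a REGULAR part plus the PENDING SHEETS `S_i ≤ 𝔪(c_S, a_v − 1)(·,x′)` on the faces
`F_i ⊆ {u_{ν_i} = c_i}` of the box, read through the current differentiated column of exponent one); conclusion: the bulk row of FILE 4α's Leibniz form
`Σ_b[κ₁D(b)K(b₊) + (κ₂V(b₋) + κ₁D(b))K(b₋) + κ₃V(b₊)K(b₊)] + κ₄·Σ_zK(z)L^{−kd}Σ_{u∈B^k(z̄)}V(u) ≤ 𝔪_k(stepBoxC, a_K + a_v − 1; δ/(4L))(p,x′)` — the torus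
step `B3Op116MajorantStep.row_step_le` for the regular part plus §2's pending pairings (the sheet composed with `K` BEFORE the face sum:
`B3Op116FaceSums.sum_majorant_face_pending_le`), at the SAME exponent and rate as on the torus.  The face charges of THIS step's Leibniz row
(`Σ_iΣ_{y∈F_i}V(y)K(y)`, p40 `DESIGN-B3-116-box.md` §1c) are not on the left side: for a value column they are resolved by `row_step_box_le`, for a
derivative column they ARE the next pending sheet.  (Sums over all bonds/sites of `T_ε`: on a box the charges vanish off `□` and the bound only improves.)
[cite: Balaban1983Higgs3, (1.16) p.414, (2.6) p.424, (2.10) p.426, p.433] [cite: Balaban1982Higgs1, (3.16) p.615] -/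
theorem row_step_box_deriv_le (hL : 1 < P.L) {k : ℕ} (hk : 1 ≤ k) (hkK : k ≤ P.K) {δ : ℝ} (hδ : 0 < δ) (hδ1 : δ ≤ 1)
    {aK av cK cv cd cS c₁ κ₁ κ₂ κ₃ κ₄ : ℝ} (haK : 0 < aK) (hav : 2 < av) (hcK : 0 ≤ cK) (hcv : 0 ≤ cv) (hcd : 0 ≤ cd) (hcS : 0 ≤ cS)
    (hc₁ : 0 ≤ c₁) (hκ₁ : 0 ≤ κ₁) (hκ₂ : 0 ≤ κ₂) (hκ₃ : 0 ≤ κ₃) (hκ₄ : 0 ≤ κ₄)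
    (i₀ : Ix N) (p x' : HiggsLattice.Site P 0)
    {nF : ℕ} (F : Fin nF → Finset (HiggsLattice.Site P 0)) (ν : Fin nF → Fin P.d)
    (c : (i : Fin nF) → ZMod (P.sitesPerDir 0 (ν i))) (hF : ∀ i, ∀ u ∈ F i, u (ν i) = c i)
    (K : HiggsLattice.Site P 0 → ℝ) (hK0 : ∀ y, 0 ≤ K y) (hK : ∀ y, K y ≤ maj P k cK aK δ p y)
    (Vf : HiggsLattice.Site P 0 → ℝ) (hV0 : ∀ y, 0 ≤ Vf y) (hV : ∀ y, Vf y ≤ maj P k cv av δ y x')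
    (S : Fin nF → HiggsLattice.Site P 0 → ℝ) (hS0 : ∀ i, ∀ u ∈ F i, 0 ≤ S i u)
    (hS : ∀ i, ∀ u ∈ F i, S i u ≤ maj P k cS (av - 1) δ u x')
    (Df : HiggsLattice.PBond P 0 → ℝ)
    (hD : ∀ b, Df b ≤ maj P k cd (av - 1) δ b.src x' + ∑ i : Fin nF, ∑ u ∈ F i, maj P k c₁ 1 δ b.src u * S i u) :
    (∑ b : HiggsLattice.PBond P 0,
        (κ₁ * Df b * K b.tgt + (κ₂ * Vf b.src + κ₁ * Df b) * K b.src + κ₃ * Vf b.tgt * K b.tgt))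
      + κ₄ * ∑ z : HiggsLattice.Site P 0, K z * (((P.L : ℝ) ^ (k * P.d))⁻¹ * ∑ u ∈ blockK k (blockIter k z), Vf u)
      ≤ maj P k (stepBoxC P N k nF δ aK av cK cv cd cS c₁ κ₁ κ₂ κ₃ κ₄) (aK + av - 1) (δ / 2 / P.L / 2) p x' := by
  have hL1 : (1 : ℝ) < (P.L : ℝ) := by exact_mod_cast hL
  have hL0 : (0 : ℝ) < (P.L : ℝ) := by linarith
  have hav1 : 1 < av := by linarith
  -- the two parts of the derivative state
  set D₁ : HiggsLattice.PBond P 0 → ℝ := fun b => maj P k cd (av - 1) δ b.src x' with hD₁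
  set D₂ : HiggsLattice.PBond P 0 → ℝ := fun b => ∑ i : Fin nF, ∑ u ∈ F i, maj P k c₁ 1 δ b.src u * S i u with hD₂
  have hD₁0 : ∀ b, 0 ≤ D₁ b := fun b => maj_nonneg hcd _ _
  have hD₂0 : ∀ b, 0 ≤ D₂ b := fun b =>
    Finset.sum_nonneg fun i _ => Finset.sum_nonneg fun u hu => mul_nonneg (maj_nonneg hc₁ _ _) (hS0 i u hu)
  have hD12 : ∀ b, Df b ≤ D₁ b + D₂ b := hD
  -- split the row: the regular part is the torus row with `D₁`, the pending part is `κ₁Σ D₂ (K₊ + K₋)`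
  have hsplit : ∑ b : HiggsLattice.PBond P 0,
        (κ₁ * Df b * K b.tgt + (κ₂ * Vf b.src + κ₁ * Df b) * K b.src + κ₃ * Vf b.tgt * K b.tgt)
      ≤ (∑ b : HiggsLattice.PBond P 0,
          (κ₁ * D₁ b * K b.tgt + (κ₂ * Vf b.src + κ₁ * D₁ b) * K b.src + κ₃ * Vf b.tgt * K b.tgt))
        + κ₁ * ∑ b : HiggsLattice.PBond P 0, D₂ b * K b.tgt + κ₁ * ∑ b : HiggsLattice.PBond P 0, D₂ b * K b.src := by
    rw [Finset.mul_sum, Finset.mul_sum, ← Finset.sum_add_distrib, ← Finset.sum_add_distrib]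
    refine Finset.sum_le_sum fun b _ => ?_
    have h1 : κ₁ * Df b * K b.tgt ≤ κ₁ * (D₁ b + D₂ b) * K b.tgt :=
      mul_le_mul_of_nonneg_right (mul_le_mul_of_nonneg_left (hD12 b) hκ₁) (hK0 _)
    have h2 : κ₁ * Df b * K b.src ≤ κ₁ * (D₁ b + D₂ b) * K b.src :=
      mul_le_mul_of_nonneg_right (mul_le_mul_of_nonneg_left (hD12 b) hκ₁) (hK0 _)
    nlinarith [h1, h2]
  -- the regular part: the torus step
  have hreg := row_step_le hL hk hkK hδ hδ1 haK hav1 hcK hcv hcd hκ₁ hκ₂ hκ₃ hκ₄ i₀ p x' K hK0 hK Vf hV0 hV D₁ hD₁0 (fun b => le_rfl)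
  -- the pending parts
  have hrate : δ / 2 / P.L / 2 ≤ δ / 2 / 2 :=
    div_le_div_of_nonneg_right (div_le_self (by positivity) hL1.le) (by norm_num)
  have hps := pair_pend_src_le hL hδ hδ1 hcK hcS hc₁ i₀ p x' F ν c hF K hK S hS0 hS haK hav
  have hpt := pair_pend_tgt_le hL hδ hδ1 hcK hcS hc₁ i₀ p x' F ν c hF K hK S hS0 hS haK hav
  have hpk : 0 ≤ pendK P N δ aK (av - 1) := pendK_nonneg hL hδ haK (by linarith)
  have tS : κ₁ * ∑ b : HiggsLattice.PBond P 0, D₂ b * K b.src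
      ≤ maj P k ((P.d : ℝ) * ((nF : ℝ) * (κ₁ * (cK * c₁ * cS * pendK P N δ aK (av - 1))))) (aK + av - 1) (δ / 2 / P.L / 2) p x' := by
    have hc : 0 ≤ cK * c₁ * cS * pendK P N δ aK (av - 1) := by positivity
    have h1 : maj P k (cK * c₁ * cS * pendK P N δ aK (av - 1)) (aK + (av - 1)) (δ / 2 / 2) p x'
        ≤ maj P k (cK * c₁ * cS * pendK P N δ aK (av - 1)) (aK + av - 1) (δ / 2 / P.L / 2) p x' := by
      rw [show aK + (av - 1) = aK + av - 1 by ring]; exact maj_rate_mono hc hrate p x'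
    refine (mul_le_mul_of_nonneg_left (hps.trans (mul_le_mul_of_nonneg_left (mul_le_mul_of_nonneg_left h1 (Nat.cast_nonneg _))
      (Nat.cast_nonneg _))) hκ₁).trans (le_of_eq ?_)
    rw [mul_maj, mul_maj, mul_maj]; ring_nf
  have tT : κ₁ * ∑ b : HiggsLattice.PBond P 0, D₂ b * K b.tgt
      ≤ maj P k ((P.d : ℝ) * ((nF : ℝ) * (κ₁ * (Real.exp 1 * cK * c₁ * cS * pendK P N δ aK (av - 1))))) (aK + av - 1)
          (δ / 2 / P.L / 2) p x' := by
    have hc : 0 ≤ Real.exp 1 * cK * c₁ * cS * pendK P N δ aK (av - 1) := by positivity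
    have h1 : maj P k (Real.exp 1 * cK * c₁ * cS * pendK P N δ aK (av - 1)) (aK + (av - 1)) (δ / 2 / 2) p x'
        ≤ maj P k (Real.exp 1 * cK * c₁ * cS * pendK P N δ aK (av - 1)) (aK + av - 1) (δ / 2 / P.L / 2) p x' := by
      rw [show aK + (av - 1) = aK + av - 1 by ring]; exact maj_rate_mono hc hrate p x'
    refine (mul_le_mul_of_nonneg_left (hpt.trans (mul_le_mul_of_nonneg_left (mul_le_mul_of_nonneg_left h1 (Nat.cast_nonneg _))
      (Nat.cast_nonneg _))) hκ₁).trans (le_of_eq ?_)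
    rw [mul_maj, mul_maj, mul_maj]; ring_nf
  -- assemble
  have hfin := add_le_add (add_le_add hreg tT) tS
  refine le_trans (by linarith [hsplit]) (hfin.trans (le_of_eq ?_))
  simp only [maj_add]
  unfold stepBoxC
  ring_nf

/-- the constant of the VALUE-column step on a box: `stepBoxC` plus the resolved face charges.
[cite: Balaban1983Higgs3, (1.16) p.414, (2.10) p.426] -/
def stepBoxVC (P : HiggsLattice.Params) (N : ℕ) (k nF : ℕ) (δ aK av cK cv cd cS c₁ κ₁ κ₂ κ₃ κ₄ κF : ℝ) : ℝ :=
  stepBoxC P N k nF δ aK av cK cv cd cS c₁ κ₁ κ₂ κ₃ κ₄ + (nF : ℝ) * (κF * (cK * cv * faceK P δ aK av))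

/-- **ONE STEP ON A BOX, VALUE COLUMN** (`a_K > 1`): the bulk Leibniz row, the block-averaged charges AND this step's face charges
`κ_F·Σ_iΣ_{y∈F_i}V(y)K(y)` (`κ_F = (2d)·ε⁻¹|e|s` for the entering/exiting legs of p40 `DESIGN-B3-116-box.md` §1c) against the three-component state:
`… ≤ 𝔪_k(stepBoxVC, a_K + a_v − 1; δ/(4L))(p,x′)` — every term, the sheet included, lands at the exponent of the torus step: THE VALUE RECURSION CLOSES
ON A BOX with no support clause on the perturbation field (p40 `DESIGN-B3-116-box.md` §2a; p35 `DESIGN-FILE4.md` §14 (d)).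
[cite: Balaban1983Higgs3, (1.16) p.414, (2.6) p.424, (2.10) p.426, p.433] [cite: Balaban1982Higgs1, (3.16) p.615] -/
theorem row_step_box_le (hL : 1 < P.L) {k : ℕ} (hk : 1 ≤ k) (hkK : k ≤ P.K) {δ : ℝ} (hδ : 0 < δ) (hδ1 : δ ≤ 1)
    {aK av cK cv cd cS c₁ κ₁ κ₂ κ₃ κ₄ κF : ℝ} (haK : 1 < aK) (hav : 2 < av) (hcK : 0 ≤ cK) (hcv : 0 ≤ cv) (hcd : 0 ≤ cd)
    (hcS : 0 ≤ cS) (hc₁ : 0 ≤ c₁) (hκ₁ : 0 ≤ κ₁) (hκ₂ : 0 ≤ κ₂) (hκ₃ : 0 ≤ κ₃) (hκ₄ : 0 ≤ κ₄) (hκF : 0 ≤ κF)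
    (i₀ : Ix N) (p x' : HiggsLattice.Site P 0)
    {nF : ℕ} (F : Fin nF → Finset (HiggsLattice.Site P 0)) (ν : Fin nF → Fin P.d)
    (c : (i : Fin nF) → ZMod (P.sitesPerDir 0 (ν i))) (hF : ∀ i, ∀ u ∈ F i, u (ν i) = c i)
    (K : HiggsLattice.Site P 0 → ℝ) (hK0 : ∀ y, 0 ≤ K y) (hK : ∀ y, K y ≤ maj P k cK aK δ p y)
    (Vf : HiggsLattice.Site P 0 → ℝ) (hV0 : ∀ y, 0 ≤ Vf y) (hV : ∀ y, Vf y ≤ maj P k cv av δ y x')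
    (S : Fin nF → HiggsLattice.Site P 0 → ℝ) (hS0 : ∀ i, ∀ u ∈ F i, 0 ≤ S i u)
    (hS : ∀ i, ∀ u ∈ F i, S i u ≤ maj P k cS (av - 1) δ u x')
    (Df : HiggsLattice.PBond P 0 → ℝ)
    (hD : ∀ b, Df b ≤ maj P k cd (av - 1) δ b.src x' + ∑ i : Fin nF, ∑ u ∈ F i, maj P k c₁ 1 δ b.src u * S i u) :
    (∑ b : HiggsLattice.PBond P 0,
        (κ₁ * Df b * K b.tgt + (κ₂ * Vf b.src + κ₁ * Df b) * K b.src + κ₃ * Vf b.tgt * K b.tgt))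
      + κ₄ * ∑ z : HiggsLattice.Site P 0, K z * (((P.L : ℝ) ^ (k * P.d))⁻¹ * ∑ u ∈ blockK k (blockIter k z), Vf u)
      + κF * ∑ i : Fin nF, ∑ y ∈ F i, Vf y * K y
      ≤ maj P k (stepBoxVC P N k nF δ aK av cK cv cd cS c₁ κ₁ κ₂ κ₃ κ₄ κF) (aK + av - 1) (δ / 2 / P.L / 2) p x' := by
  have hL1 : (1 : ℝ) < (P.L : ℝ) := by exact_mod_cast hL
  have hav1 : 1 < av := by linarith
  have hbulk := row_step_box_deriv_le hL hk hkK hδ hδ1 (by linarith) hav hcK hcv hcd hcS hc₁ hκ₁ hκ₂ hκ₃ hκ₄ i₀ p x' F ν c hF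
    K hK0 hK Vf hV0 hV S hS0 hS Df hD
  have hface := pair_face_le hL hδ hδ1 hcK hcv p x' F ν c hF K hK0 hK Vf hV0 hV haK hav1
  have hrate : δ / 2 / P.L / 2 ≤ δ / 2 := by
    rw [div_div, div_le_iff₀ (by positivity)]; nlinarith
  have hc : 0 ≤ cK * cv * faceK P δ aK av := mul_nonneg (mul_nonneg hcK hcv) (faceK_nonneg hL hδ haK hav1)
  have tF : κF * ∑ i : Fin nF, ∑ y ∈ F i, Vf y * K y
      ≤ maj P k ((nF : ℝ) * (κF * (cK * cv * faceK P δ aK av))) (aK + av - 1) (δ / 2 / P.L / 2) p x' := by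
    refine (mul_le_mul_of_nonneg_left (hface.trans (mul_le_mul_of_nonneg_left (maj_rate_mono hc hrate p x') (Nat.cast_nonneg _)))
      hκF).trans (le_of_eq ?_)
    rw [mul_maj, mul_maj]; ring_nf
  refine (add_le_add hbulk tF).trans (le_of_eq ?_)
  rw [maj_add]
  rfl

end StepBox

end Literature.MathematicalPhysics.QuantumFieldTheory.Balaban1983to89.B3Op116MajorantStepBox

end
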